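import Literature.NumberTheory.GaloisRepresentations.LubinTateColemanCoordUnipotentTwo
import Literature.NumberTheory.GaloisRepresentations.LubinTateColemanRelativeCoordGaloisTwo
import HarnessLib

/-!
# The `Gal(E·K_π^∞/E) ≅ 𝒪_F^×`-action on the RELATIVE Coleman coordinates `𝒪_E⟦Y⟧` is pro-unipotent at `q = 2`
# (the two-variable tower: `r_{σ̃β} − r_β ∈ (π, Y)^{N+1}` for `r_β ∈ (π, Y)^N`, `σ̃` fixing the unramified base `E`)

De Shalit, *Iwasawa theory of elliptic curves with complex multiplication* (1987), Ch. I §3.4 Lemma (ii), §3.7–3.8: over the unramified base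
`k′ = E` the coordinates `r_β ∈ 𝒪_E⟦Y⟧` of Theorem I.3.7 carry the semilinear action `r_{σ̃β} = χ(σ̃)·ι ρ_χ·(r_β ∘ [χ]_f)` of the
`σ̃ ∈ Γ_F` fixing `E` (`relUnitCoordTwo_galAct`).  Relative version of `LubinTateColemanCoordUnipotentTwo`: with `I_N` the coefficientwise
`(π, Y)`-adic filtration of `𝒪_E⟦Y⟧` (`LubinTate.adicFiltGen (algebraMap 𝒪_F 𝒪_E π)`),

* `constantCoeff_homE_coeff_one` (`[v]_f′(0) = v` in `𝒪_E`), `algebraMap_unit_sub_one_mem_two` / `coeff_one_homE_sub_one_mem` (`≡ 1 (mod π)` at `q = 2`),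
  `constantCoeff_map_evenPartTwo_unitTwistSerTwo` (`ι ρ_v(0) = 1`);
* ★★ `relUnitCoordTwo_galAct_sub_mem_adicFiltGen_succ` — **`r_β ∈ I_N ⟹ r_{σ̃β} − r_β ∈ I_{N+1}`** for every `σ̃ ∈ Γ_F` fixing `E`
  pointwise: the Lubin–Tate direction of `Gal(E·K_π^∞/F)` acts pro-unipotently on the coordinate module of the two-variable tower, the
  continuity input for its `𝒪_E⟦T⟧`-module structure (`T = σ̃_γ − 1`).

Everything PROVED (0 sorry, no named facts, no new definitions).

## References

* E. de Shalit, *Iwasawa theory of elliptic curves with complex multiplication* (1987), Ch. I §3.1, §3.4 Lemma (ii), §3.7. [deShalit1987]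
-/

noncomputable section

open scoped PowerSeries.WithPiTopology

namespace Literature.NumberTheory.GaloisRepresentations

section RelativeCoordUnipotentTwo

open GaloisRepresentations.IsNonarchimedeanLocalField LubinTate ValuativeRel Field

variable {F : Type} [Field F] [ValuativeRel F] [TopologicalSpace F] [IsNonarchimedeanLocalField F]

attribute [local instance] ltNormUniformSpace ltNormIsUniformAddGroup rk1 nF nE fintypeResidueField

variable {π : 𝒪[F]} (hπ : (valuation F).IsUniformizer (π : F))
variable (E : IntermediateField F (AlgebraicClosure F)) [FiniteDimensional F E]

/-- The two coefficient maps `LTCoeff F → 𝒪_E` and `𝒪_F → 𝒪_E` agree. [folklore] -/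
private theorem algebraMap_LTCoeff_eq' (w : LTCoeff F) :
    algebraMap (LTCoeff F) (unitBall E) w = algebraMap 𝒪[F] (unitBall E) ((LTCoeff.of F).symm w) := by
  change algebraMap (LTCoeff F) (unitBall E) w = algebraMap (LTCoeff F) (unitBall E) ((LTCoeff.of F) ((LTCoeff.of F).symm w))
  rw [RingEquiv.apply_symm_apply]

/-- `[v]_f′(0) = v` read in `𝒪_E`. [cite: deShalit1987, Ch. I §1.5] -/
theorem constantCoeff_homE_coeff_one (v : 𝒪[F]) : PowerSeries.coeff 1 (homE hπ E v) = algebraMap 𝒪[F] (unitBall E) v := by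
  rw [homE, PowerSeries.coeff_map, coeff_one_hom, algebraMap_LTCoeff_eq', RingEquiv.symm_apply_apply]

include hπ in
/-- At `q = 2`: `v − 1 ∈ (π)𝒪_E` for every unit `v ∈ 𝒪_F^×` (read in `𝒪_E`). [cite: deShalit1987, Ch. I §3.1 (p = 2)] -/
theorem algebraMap_unit_sub_one_mem_two (hq : residueFieldCard F = 2) (v : 𝒪[F]ˣ) :
    algebraMap 𝒪[F] (unitBall E) (v : 𝒪[F]) - 1 ∈ Ideal.span {algebraMap 𝒪[F] (unitBall E) π} := by
  obtain ⟨c, hc⟩ := Ideal.mem_span_singleton'.mp (sub_one_mem_span_pi_of_isUnit_two hπ hq v)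
  refine Ideal.mem_span_singleton'.mpr ⟨algebraMap (LTCoeff F) (unitBall E) c, ?_⟩
  have h := congrArg (algebraMap (LTCoeff F) (unitBall E)) hc
  rw [map_mul, map_sub, map_one, algebraMap_LTCoeff_eq' E (LTCoeff.of F π), algebraMap_LTCoeff_eq' E (LTCoeff.of F (v : 𝒪[F])),
    RingEquiv.symm_apply_apply, RingEquiv.symm_apply_apply] at h
  exact h

include hπ in
/-- At `q = 2`: `[v]_f′(0) − 1 = v − 1 ∈ (π)𝒪_E` for every unit `v`. [cite: deShalit1987, Ch. I §3.1 (p = 2)] -/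
theorem coeff_one_homE_sub_one_mem (hq : residueFieldCard F = 2) (v : 𝒪[F]ˣ) :
    PowerSeries.coeff 1 (homE hπ E (v : 𝒪[F])) - 1 ∈ Ideal.span {algebraMap 𝒪[F] (unitBall E) π} := by
  rw [constantCoeff_homE_coeff_one]
  exact algebraMap_unit_sub_one_mem_two hπ E hq v

include hπ in
/-- `ι ρ_v(0) = 1` (the twist `ρ_v` read in `𝒪_E⟦Y⟧`). [cite: deShalit1987, Ch. I §3.4 Lemma (ii)] -/
theorem constantCoeff_map_evenPartTwo_unitTwistSerTwo (hq : residueFieldCard F = 2) {t : LTCoeff F}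
    (ht : (2 : LTCoeff F) = LTCoeff.of F π * t) (v : 𝒪[F]ˣ) :
    PowerSeries.constantCoeff ((evenPartTwo hπ hq (unitTwistSerTwo hπ t v)).map (algebraMap (LTCoeff F) (unitBall E))) = 1 := by
  rw [← PowerSeries.coeff_zero_eq_constantCoeff_apply, PowerSeries.coeff_map, PowerSeries.coeff_zero_eq_constantCoeff_apply,
    constantCoeff_evenPartTwo_unitTwistSerTwo hπ hq ht v, map_one]

variable [Normal F E] [IsGalois F E] (hq : residueFieldCard F = 2) (hE : E ≤ maxUnramified F) {σ₀ : absoluteGaloisGroup F}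
  (hσ₀ : IsAbsArithFrob σ₀)

/-- ★★ **The Lubin–Tate direction acts pro-unipotently on the relative coordinates**: for `σ̃ ∈ Γ_F` fixing `E` pointwise and
`r_β ∈ I_N = (π, Y)^N ⊆ 𝒪_E⟦Y⟧`, **`r_{σ̃β} − r_β ∈ I_{N+1}`** (`r_{σ̃β} − r_β = (χ ι ρ_χ − 1)·(r_β ∘ [χ]) + (r_β ∘ [χ] − r_β)`, both in `I_{N+1}`
since `χ ≡ 1`, `ρ_χ(0) = 1`, `[χ]′(0) = χ ≡ 1 (mod π)`). [cite: deShalit1987, Ch. I §3.4 Lemma (ii); §3.1] -/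
theorem relUnitCoordTwo_galAct_sub_mem_adicFiltGen_succ (u : (LTCoeff F)ˣ) (hu : LTCoeff.of F π = residueFieldCard F * u)
    (β : RelNormCoherentUnits hπ E) {σ : absoluteGaloisGroup F} (hσE : ∀ x : E, σ • (x : AlgebraicClosure F) = x) {N : ℕ}
    (hβ : relUnitCoordTwo hπ E hq hE hσ₀ u hu β ∈ adicFiltGen (algebraMap 𝒪[F] (unitBall E) π) N) :
    relUnitCoordTwo hπ E hq hE hσ₀ u hu (β.galAct σ) - relUnitCoordTwo hπ E hq hE hσ₀ u hu β ∈
      adicFiltGen (algebraMap 𝒪[F] (unitBall E) π) (N + 1) := by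
  have ht := two_eq_of_mul_inv hq u hu
  obtain ⟨H, hH⟩ : ∃ H : PowerSeries (unitBall E), H = homE hπ E (lubinTateChar hπ σ : 𝒪[F]) := ⟨_, rfl⟩
  have hH0 : PowerSeries.constantCoeff H = 0 := by rw [hH]; exact constantCoeff_homE hπ E _
  have hH1 : PowerSeries.coeff 1 H - 1 ∈ Ideal.span {algebraMap 𝒪[F] (unitBall E) π} := by
    rw [hH]; exact coeff_one_homE_sub_one_mem hπ E hq _
  obtain ⟨ρ, hρ⟩ : ∃ ρ : PowerSeries (unitBall E),
      ρ = (evenPartTwo hπ hq (unitTwistSerTwo hπ (↑u⁻¹ : LTCoeff F) (lubinTateChar hπ σ))).map (algebraMap (LTCoeff F) (unitBall E)) :=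
    ⟨_, rfl⟩
  have hρ1 : PowerSeries.C (algebraMap 𝒪[F] (unitBall E) (lubinTateChar hπ σ : 𝒪[F])) * ρ - 1 ∈
      adicFiltGen (algebraMap 𝒪[F] (unitBall E) π) 1 := by
    refine mem_adicFiltGen_one_of_constantCoeff_mem ?_
    rw [map_sub, map_one, map_mul, PowerSeries.constantCoeff_C, hρ, constantCoeff_map_evenPartTwo_unitTwistSerTwo hπ E hq ht, mul_one]
    exact algebraMap_unit_sub_one_mem_two hπ E hq _
  rw [relUnitCoordTwo_galAct hπ E hq hE hσ₀ u hu β hσE, ← hH, ← hρ]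
  have e : PowerSeries.C (algebraMap 𝒪[F] (unitBall E) (lubinTateChar hπ σ : 𝒪[F])) * ρ *
      (relUnitCoordTwo hπ E hq hE hσ₀ u hu β).subst H - relUnitCoordTwo hπ E hq hE hσ₀ u hu β =
      (PowerSeries.C (algebraMap 𝒪[F] (unitBall E) (lubinTateChar hπ σ : 𝒪[F])) * ρ - 1) * (relUnitCoordTwo hπ E hq hE hσ₀ u hu β).subst H +
        ((relUnitCoordTwo hπ E hq hE hσ₀ u hu β).subst H - relUnitCoordTwo hπ E hq hE hσ₀ u hu β) := by ring
  rw [e]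
  refine add_mem ?_ (subst_sub_self_mem_adicFiltGen_succ hH0 hH1 N hβ)
  have h := mul_mem_adicFiltGen hρ1 (subst_mem_adicFiltGen_of_mem hH0 hH1 N hβ)
  rwa [Nat.add_comm] at h

end RelativeCoordUnipotentTwo

end Literature.NumberTheory.GaloisRepresentations
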